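import Literature.NumberTheory.Automorphic.UnitaryGroupIsotropicVectorBoundedHeight
import HarnessLib

/-!
# Every isotropic rational vector of `(E³, J₃)` is the last row of a rational unitary matrix;
# the Siegel domain `{H ≥ c₀}` covers `U(J₃)(F)\U(J₃)(𝔸_F)`

Topic `NumberTheory/Automorphic`; namespace `Literature.NumberTheory.Automorphic.UnitaryGroup`.
Proof file: theorems only (no definition, no named fact, no instance, no `sorry`); imports = tree.
Setting: the quasi-split unitary group `U(J₃)` of the quadratic extension `E/F` with involution `c`
(`c * c = 1`), `J₃ = antidiag(1, 1, 1)`, the hermitian form `⟨ξ, η⟩ = Σ_i ξ_i c(η_{rev i})` on `E³`,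
the rational points `G(F) = (quasiSplit F E c 3).Rational` and the Iwasawa / Borel height
`H = borelHeight` of `UnitaryGroupBorelHeight` (`H(g) = h(e₃ g)⁻¹`).

* §1 `exists_rational_lastRow_eq_vecCons` — for `x, z ∈ E` with `z + c z + x c x = 0` the LOWER
  unitriangular matrix `[[1,0,0],[-c x,1,0],[z,x,1]] = J u(x,z) J` is a rational point of `U(J₃)`
  with last row `(z, x, 1)`; `exists_rational_lastRow_eq_single_zero` — the Weyl element `J₃` is a
  rational point with last row `e₁ = (1, 0, 0)` (Rogawski (1990), §1.10: `N = {u(x, z)}`, `w = J`).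
* §2 **`exists_rational_lastRow_eq_smul`** — WITT FOR ISOTROPIC LINES OF `(E³, J₃)`: every isotropic
  `ξ ≠ 0` is, up to a non-zero scalar, the last row of some `γ ∈ U(J₃)(F)` (case `ξ₃ ≠ 0`: scale to
  `ξ₃ = 1` and use §1; case `ξ₃ = 0`: isotropy forces `ξ₂ = 0`, so `ξ ∈ E e₁` and the Weyl element does
  it). Equivalently `U(J₃)(F)` is transitive on isotropic lines.
* §3 **`exists_pos_forall_exists_le_borelHeight`** — THE COVERING: there is `c₀ > 0` such that every
  `g ∈ U(J₃)(𝔸_F)` has a rational translate `γ g`, `γ ∈ U(J₃)(F)`, of height `H(γ g) ≥ c₀` (★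
  `exists_forall_exists_isotropic_vecHeight_le`: an isotropic `ξ` with `h(ξ g) ≤ B`; §2: `ξ = a · e₃ γ`;
  `H(γ g) = h(e₃ γ g)⁻¹ = h(ξ g)⁻¹ ≥ B⁻¹` by the product formula ★ `vecHeight_smul_algebraMap`). With
  ★ `borelHeight_mul_borelHeight_le_one_of_not_mem_arithmeticBorel` (the Siegel property) and ★
  `finite_setOf_lt_borelHeight` this is the reduction theory of `U(J₃)` in the form used by the
  truncated kernel: `G(𝔸_F) = G(F) · {g : H(g) ≥ c₀}` (Borel (1963), §5; Godement (1962/63), §3;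
  Rogawski (1990), §2.1–2.2).

## References

* J. D. Rogawski, *Automorphic Representations of Unitary Groups in Three Variables* (1990), §1.10,
  §2.1 [Rogawski1990].
* A. Borel, *Some finiteness properties of adele groups over number fields*, Publ. Math. IHÉS 16
  (1963), §5 [Borel1963].
* R. Godement, *Domaines fondamentaux des groupes arithmétiques*, Sém. Bourbaki 257 (1962/63), §3
  [Godement1964].
-/

set_option autoImplicit false

noncomputable section

open NumberField IsDedekindDomain Matrix
open scoped NNReal MatrixGroups

namespace Literature.NumberTheory.Automorphic

namespace UnitaryGroup

variable {F E : Type} [Field F] [NumberField F] [Field E] [NumberField E] [Algebra F E]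
  {c : E ≃ₐ[F] E}

/-! ## §1 Two explicit rational unitary matrices -/

omit [NumberField F] [NumberField E] in
/-- `rev` on `Fin 3` (index plumbing). [cite: Rogawski1990, §1.10] -/
private theorem rev_fin_three :
    (0 : Fin 3).rev = 2 ∧ (1 : Fin 3).rev = 1 ∧ (2 : Fin 3).rev = 0 := ⟨rfl, rfl, rfl⟩

/-- **The lower unitriangular unitary matrix `J u(x, z) J = [[1,0,0],[-c x,1,0],[z,x,1]]`**: for
`z + c z + x c x = 0` it is a rational point of `U(J₃)` whose last row is `(z, x, 1)` (the conjugate by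
the Weyl element of Rogawski's `u(x, z) ∈ N(F)`, Rogawski (1990), §1.10). [cite: Rogawski1990, §1.10] -/
theorem exists_rational_lastRow_eq_vecCons (hc : c * c = 1) {x z : E} (hxz : z + c z + x * c x = 0) :
    ∃ γ : (quasiSplit F E c 3).Rational,
      (fun j : Fin 3 => ((γ.1 : GL (Fin 3) E) : Matrix (Fin 3) (Fin 3) E) ⊤ j) = ![z, x, 1] := by
  have hcc : ∀ y : E, c (c y) = y := fun y => by rw [← AlgEquiv.mul_apply, hc, AlgEquiv.one_apply]
  have hcz : c z = -z - x * c x := by linear_combination hxz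
  -- the matrix and its inverse
  set A : Matrix (Fin 3) (Fin 3) E := !![1, 0, 0; -c x, 1, 0; z, x, 1] with hA
  set B : Matrix (Fin 3) (Fin 3) E := !![1, 0, 0; c x, 1, 0; c z, -x, 1] with hB
  have hAB : A * B = 1 := by
    ext i j
    fin_cases i <;> fin_cases j <;> simp [hA, hB, Matrix.mul_apply, Fin.sum_univ_three, hcz]
  have hBA : B * A = 1 := by
    ext i j
    fin_cases i <;> fin_cases j <;> simp [hA, hB, Matrix.mul_apply, Fin.sum_univ_three, hcz]
  set g : GL (Fin 3) E := ⟨A, B, hAB, hBA⟩ with hg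
  have hmem : g ∈ unitaryGroupOfForm (c : E →+* E) ((StdForm.antidiagonal 3).over E) := by
    rw [mem_unitaryGroupOfForm_antidiagonal_iff_sum']
    obtain ⟨r0, r1, r2⟩ := rev_fin_three
    intro a b
    fin_cases a <;> fin_cases b <;>
      simp [hg, hA, Fin.sum_univ_three, r0, r1, r2, hcc, map_neg, map_one, map_zero]
    linear_combination hxz
  refine ⟨⟨g, hmem⟩, ?_⟩
  funext j
  have htop : (⊤ : Fin 3) = 2 := rfl
  fin_cases j <;> simp [hg, hA, htop]

/-- **The Weyl element `J₃ = antidiag(1, 1, 1)` is a rational point of `U(J₃)`**, with last row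
`e₁ = (1, 0, 0)` (Rogawski (1990), §1.10, `w`). [cite: Rogawski1990, §1.10] -/
theorem exists_rational_lastRow_eq_vecCons_one_zero_zero :
    ∃ w : (quasiSplit F E c 3).Rational,
      (fun j : Fin 3 => ((w.1 : GL (Fin 3) E) : Matrix (Fin 3) (Fin 3) E) ⊤ j) = ![1, 0, 0] := by
  set A : Matrix (Fin 3) (Fin 3) E := !![0, 0, 1; 0, 1, 0; 1, 0, 0] with hA
  have hAA : A * A = 1 := by
    ext i j
    fin_cases i <;> fin_cases j <;> simp [hA, Matrix.mul_apply, Fin.sum_univ_three]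
  set g : GL (Fin 3) E := ⟨A, A, hAA, hAA⟩ with hg
  have hmem : g ∈ unitaryGroupOfForm (c : E →+* E) ((StdForm.antidiagonal 3).over E) := by
    rw [mem_unitaryGroupOfForm_antidiagonal_iff_sum']
    obtain ⟨r0, r1, r2⟩ := rev_fin_three
    intro a b
    fin_cases a <;> fin_cases b <;>
      simp [hg, hA, Fin.sum_univ_three, r0, r1, r2, map_one, map_zero]
  refine ⟨⟨g, hmem⟩, ?_⟩
  funext j
  have htop : (⊤ : Fin 3) = 2 := rfl
  fin_cases j <;> simp [hg, hA, htop]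

/-! ## §2 Witt for isotropic lines -/

/-- **WITT'S THEOREM FOR THE ISOTROPIC LINES OF `(E³, J₃)`**: every isotropic `ξ ≠ 0`
(`Σ_i ξ_i c(ξ_{rev i}) = 0`) is, up to a non-zero scalar `a ∈ E`, the last row `e₃ γ` of a rational
point `γ ∈ U(J₃)(F)` — `U(J₃)(F)` acts transitively on the isotropic lines, whose stabiliser is the
Borel subgroup (Rogawski (1990), §1.10). [cite: Rogawski1990, §1.10] -/
theorem exists_rational_lastRow_eq_smul (hc : c * c = 1) {ξ : Fin 3 → E} (hξ : ξ ≠ 0)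
    (hiso : ∑ i, ξ i * c (ξ (Fin.rev i)) = 0) :
    ∃ γ : (quasiSplit F E c 3).Rational, ∃ a : E, a ≠ 0 ∧
      (fun j : Fin 3 => ((γ.1 : GL (Fin 3) E) : Matrix (Fin 3) (Fin 3) E) ⊤ j) = a • ξ := by
  obtain ⟨r0, r1, r2⟩ := rev_fin_three
  have hiso' : ξ 0 * c (ξ 2) + ξ 1 * c (ξ 1) + ξ 2 * c (ξ 0) = 0 := by
    simpa [Fin.sum_univ_three, r0, r1, r2] using hiso
  by_cases h2 : ξ 2 = 0
  · -- `ξ = (ξ₀, 0, 0)`: the Weyl element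
    have h1 : ξ 1 = 0 := by
      have h : ξ 1 * c (ξ 1) = 0 := by simpa [h2] using hiso'
      rcases mul_eq_zero.1 h with h | h
      · exact h
      · exact (EmbeddingLike.map_eq_zero_iff).1 h
    have h0 : ξ 0 ≠ 0 := by
      intro h0
      apply hξ
      funext j
      fin_cases j <;> simp [h0, h1, h2]
    obtain ⟨w, hw⟩ := exists_rational_lastRow_eq_vecCons_one_zero_zero (F := F) (E := E) (c := c)
    refine ⟨w, (ξ 0)⁻¹, inv_ne_zero h0, ?_⟩
    rw [hw]
    funext j
    fin_cases j <;> simp [h0, h1, h2]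
  · -- `ξ₃ ≠ 0`: scale to `ξ₃ = 1` and use the lower unitriangular element
    set a : E := (ξ 2)⁻¹ with ha
    have ha2 : a * ξ 2 = 1 := inv_mul_cancel₀ h2
    have hca2 : c a * c (ξ 2) = 1 := by rw [← map_mul, ha2, map_one]
    have hxz : a * ξ 0 + c (a * ξ 0) + a * ξ 1 * c (a * ξ 1) = 0 := by
      rw [map_mul, map_mul]
      linear_combination (a * c a) * hiso' - (a * ξ 0) * hca2 - (c a * c (ξ 0)) * ha2
    obtain ⟨γ, hγ⟩ := exists_rational_lastRow_eq_vecCons (F := F) hc hxz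
    refine ⟨γ, a, inv_ne_zero h2, ?_⟩
    rw [hγ]
    funext j
    fin_cases j <;> simp [ha2]

/-! ## §3 The covering: a rational translate of bounded-below height -/

/-- `(a ξ)_𝔸 = a_𝔸 • ξ_𝔸` (plumbing). [cite: Garrett2018, §2.2 (PDF p. 81)] -/
theorem principalVec_smul (a : E) (ξ : Fin 3 → E) :
    principalVec E (a • ξ) = algebraMap E (AdeleRing (𝓞 E) E) a • principalVec E ξ := by
  funext i
  simp [principalVec_apply, map_mul, smul_eq_mul]

/-- **THE COVERING OF `U(J₃)(𝔸_F)` BY RATIONAL TRANSLATES OF THE SIEGEL DOMAIN `{H ≥ c₀}`.** There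
is `c₀ > 0` such that every `g ∈ U(J₃)(𝔸_F)` has a translate `γ g`, `γ ∈ U(J₃)(F)`, with
`H(γ g) ≥ c₀` (`H = borelHeight`, the Iwasawa height `h(e₃ g)⁻¹`): an isotropic rational vector `ξ` of
height `h(ξ g) ≤ B` (★ `exists_forall_exists_isotropic_vecHeight_le`) is `a · e₃ γ` (§2), and
`h(e₃ γ g) = h(a⁻¹ ξ g) = h(ξ g)` by the product formula. Reduction theory for `U(3)` (Rogawski (1990),
§2.1–2.2; Borel (1963), §5): with the Siegel property ★
`borelHeight_mul_borelHeight_le_one_of_not_mem_arithmeticBorel`, `G(𝔸_F) = G(F) · {H ≥ c₀}`.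
[cite: Rogawski1990, §2.1 (p. 12)] [cite: Borel1963, §5] -/
theorem exists_pos_forall_exists_le_borelHeight (hc : c * c = 1) :
    ∃ c₀ : ℝ≥0, 0 < c₀ ∧ ∀ g : (quasiSplit F E c 3).Adelic,
      ∃ γ : (quasiSplit F E c 3).Rational, c₀ ≤ borelHeight ((quasiSplit F E c 3).toAdelic γ * g) := by
  classical
  obtain ⟨B, hB⟩ := exists_forall_exists_isotropic_vecHeight_le (F := F) (E := E) (c := c) (N := 3)
    (by norm_num)
  have hB1 : 0 < max B 1 := lt_of_lt_of_le zero_lt_one (le_max_right _ _)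
  refine ⟨(max B 1)⁻¹, inv_pos.2 hB1, fun g => ?_⟩
  obtain ⟨ξ, hξ, hiso, hle⟩ := hB g
  obtain ⟨γ, a, ha, hrow⟩ := exists_rational_lastRow_eq_smul hc hξ hiso
  refine ⟨γ, ?_⟩
  have hlast : lastRow ((quasiSplit F E c 3).toAdelic γ * g) =
      algebraMap E (AdeleRing (𝓞 E) E) a •
        (principalVec E ξ ᵥ* (adelicVal F E c 3 _ g : Matrix (Fin 3) (Fin 3) (AdeleRing (𝓞 E) E))) := by
    rw [lastRow_mul, lastRow_toAdelic, hrow, principalVec_smul, Matrix.smul_vecMul]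
  have hfin : IsHeightFinite E
      (principalVec E ξ ᵥ* (adelicVal F E c 3 _ g : Matrix (Fin 3) (Fin 3) (AdeleRing (𝓞 E) E))) :=
    isHeightFinite_principalVec_vecMul hξ _
  have hh : vecHeight E (lastRow ((quasiSplit F E c 3).toAdelic γ * g)) =
      vecHeight E (principalVec E ξ ᵥ* (adelicVal F E c 3 _ g : Matrix (Fin 3) (Fin 3) (AdeleRing (𝓞 E) E))) := by
    rw [hlast]
    exact vecHeight_smul_algebraMap hfin (Units.mk0 a ha)
  -- positivity of the height of a non-zero rational vector
  have hpos : 0 < vecHeight E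
      (principalVec E ξ ᵥ* (adelicVal F E c 3 _ g : Matrix (Fin 3) (Fin 3) (AdeleRing (𝓞 E) E))) := by
    have h1 := one_le_matHeightBound_mul_vecHeight (K := E) hξ (adelicVal F E c 3 _ g)
    by_contra h
    rw [not_lt, le_zero_iff] at h
    rw [h, mul_zero] at h1
    exact absurd h1 (not_le.2 zero_lt_one)
  rw [borelHeight_def, hh]
  exact inv_anti₀ hpos (hle.trans (le_max_left _ _))

end UnitaryGroup

end Literature.NumberTheory.Automorphic
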